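import Literature.Computability.Complexity.OracleClockFst
import Literature.Computability.Complexity.OracleComposition
import Literature.Computability.Complexity.ListBricks
import HarnessLib

/-!
# Oracle-algorithm combinators: blank prefix queries, output post-processing, erased answers

Toolkit file (transcript model of `Oracle.lean`: an oracle algorithm is a step function
`(input, answers so far) ↦ query | output`), companion of `OracleQueryMap.lean` (`mapQuery`,
`clock`, `capQ`, `comap`) and `OracleClosure.lean` (`prePost`). Three further step-level
combinators, each with its run semantics and the proof that it preserves polynomial time
(assembled, as there, from the `FinTM2` toolkit by composition — duplicate the step arguments,
run the given step machine on the first field (`PolyTimeComputable.firstField`), post-process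
with an `FP` string map; no Turing machine is programmed):

* `M.prefixShift k` — first ask `k` blank queries `ε` (whatever the surrounding query rewriting
  `mapQuery` makes of them), then run `M` on the answers received AFTER those `k`
  (`runAux_prefixShift_of_le`; `isPolyTime_prefixShift`). This is the shape "draw some labelled
  examples first, then run the learner" of reductions between learning and distinguishing
  (Kearns–Valiant 1994, §3; used for `Learning/CryptoHardness.lean`).
* `M.postOut h` — turn the string output `w` of `M` into the bit
  `(h ⟨x, ⟨listBool answers, w⟩⟩).headD false` computed by an `FP` map `h` from the input, the
  whole transcript and `w` (`runAux_postOut`; `isPolyTime_postOut`); the output analogue of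
  `mapQuery`.
* `M.eraseAns` — feed `M` empty answers: against every oracle it runs as `M` against the oracle
  `fun _ => []` (`runAux_eraseAns`; `isPolyTime_eraseAns`).
* `runEmptyLang E` — the language `{⟨u, y⟩ | E run on y for |u| rounds, every query answered ε,
  outputs 1}` of budgeted oracle-free runs (the hypothesis evaluations `evalHyp` of
  `Learning/PAC.lean`); **`runEmptyLang_mem_P`**: it is in `P` for polynomial-time `E`, by the
  clocked simulator `runEmptyAlg E = ((E.eraseAns.mapQuery ε).comap snd).clockFst X 0`, which
  decides it relative to ANY oracle (`runEmptyLang_mem_PRel`), and `P^∅ = P` (`PRel_empty_holds`).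

## References

* S. Arora, B. Barak, *Computational Complexity: A Modern Approach*, CUP 2009, §3.4 (oracle
  machines: the configuration is determined by the input and the answers), §1.3 with Claim 1.6
  (polynomial-time computations compose) [AroraBarak2009].
* M. Kearns, L. Valiant, *Cryptographic limitations on learning Boolean formulae and finite
  automata*, J. ACM 41 (1994) 67–95, §3 (learning algorithms as distinguishers) [KearnsValiant1994].
-/

namespace Literature.Computability.Complexity

open _root_.Computability

namespace OracleAlg

variable {β : Type}

/-! ### Blank prefix queries -/

/-- **`M.prefixShift k`**: while fewer than `k` answers have been received ask the blank query
`ε`; afterwards run `M` on the input and the answers received after the first `k`.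
[Kearns–Valiant 1994, §3 (draw examples, then run the learner); Arora–Barak 2009, §3.4] [folklore] -/
def prefixShift (M : OracleAlg β) (k : ℕ) : OracleAlg β where
  step x as := if as.length < k then Sum.inl [] else M.step x (as.drop k)

/-- The step of `M.prefixShift k` (definitional). [folklore] -/
theorem prefixShift_step (M : OracleAlg β) (k : ℕ) (x : List Bool) (as : List (List Bool)) :
    (M.prefixShift k).step x as = if as.length < k then Sum.inl [] else M.step x (as.drop k) :=
  rfl

/-- Once `k` answers are in, `M.prefixShift k` runs as `M` on the later answers. [Arora–Barak 2009, §3.4] [folklore] -/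
theorem runAux_prefixShift_of_le (M : OracleAlg β) (k : ℕ) (O : Oracle) (x : List Bool) :
    ∀ (n : ℕ) (as : List (List Bool)), k ≤ as.length →
      (M.prefixShift k).runAux O x n as = M.runAux O x n (as.drop k)
  | 0, _, _ => rfl
  | n + 1, as, h => by
    rw [runAux_succ, runAux_succ, prefixShift_step, if_neg (by omega)]
    cases M.step x (as.drop k) with
    | inr b => rfl
    | inl q =>
      dsimp only
      rw [runAux_prefixShift_of_le M k O x n (as ++ [O q]) (by simp; omega),
        List.drop_append_of_le_length h]

/-- Before that, each round asks the blank query and records the answer `O ε`. [folklore] -/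
theorem runAux_prefixShift_of_lt (M : OracleAlg β) (k : ℕ) (O : Oracle) (x : List Bool) (n : ℕ)
    {as : List (List Bool)} (h : as.length < k) :
    (M.prefixShift k).runAux O x (n + 1) as = (M.prefixShift k).runAux O x n (as ++ [O []]) := by
  rw [runAux_succ, prefixShift_step, if_pos h]

/-- Hence from the empty transcript: `k` blank rounds, then the run of `M`. [folklore] -/
theorem runAux_prefixShift_replicate (M : OracleAlg β) (k : ℕ) (O : Oracle) (x : List Bool) (n : ℕ) :
    ∀ j ≤ k, (M.prefixShift k).runAux O x (n + j) (List.replicate (k - j) (O [])) = M.runAux O x n []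
  | 0, _ => by
    rw [Nat.add_zero, Nat.sub_zero, runAux_prefixShift_of_le M k O x n _ (by simp)]
    simp
  | j + 1, hj => by
    rw [← Nat.add_assoc, runAux_prefixShift_of_lt M k O x (n + j) (by simp; omega)]
    have : List.replicate (k - (j + 1)) (O []) ++ [O []] = List.replicate (k - j) (O []) := by
      rw [← List.replicate_succ', show k - j = k - (j + 1) + 1 by omega]
    rw [this]
    exact runAux_prefixShift_replicate M k O x n j (by omega)

/-- **Run semantics of `prefixShift`**: with `k` extra rounds, `M.prefixShift k` outputs what `M`
outputs. [Arora–Barak 2009, §3.4] [folklore] -/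
theorem run_prefixShift (M : OracleAlg β) (k : ℕ) (O : Oracle) (x : List Bool) (n : ℕ) :
    (M.prefixShift k).run O (n + k) x = M.run O n x := by
  have h := runAux_prefixShift_replicate M k O x n k le_rfl
  simpa [run] using h

/-! ### Post-processing the output with the transcript in hand -/

/-- **`M.postOut h`**: queries of `M` unchanged; an output `w` of `M` after answers `as` on input
`x` becomes the bit `(h ⟨x, ⟨listBool as, w⟩⟩).headD false`. [Arora–Barak 2009, §3.4] [folklore] -/
def postOut (M : OracleAlg (List Bool)) (h : List Bool → List Bool) : OracleAlg Bool where
  step x as :=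
    match M.step x as with
    | Sum.inl q => Sum.inl q
    | Sum.inr w =>
      Sum.inr ((h (boolPair x (boolPair ((encodingList Bool).listBool.encode as) w))).headD false)

/-- The step of `M.postOut h` (definitional). [folklore] -/
theorem postOut_step (M : OracleAlg (List Bool)) (h : List Bool → List Bool) (x : List Bool)
    (as : List (List Bool)) :
    (M.postOut h).step x as =
      match M.step x as with
      | Sum.inl q => Sum.inl q
      | Sum.inr w =>
        Sum.inr ((h (boolPair x (boolPair ((encodingList Bool).listBool.encode as) w))).headD false) :=
  rfl

/-- **Run semantics of `postOut`** along a trace: if after the answers to `us[0..i)` the step of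
`M` asks `us[i]` and after all of them it outputs `w`, then `M.postOut h` with fuel `> |us|`
outputs the post-processed bit and has the same transcript. [Arora–Barak 2009, §3.4] [folklore] -/
theorem runAux_postOut_of_trace (M : OracleAlg (List Bool)) (h : List Bool → List Bool) (O : Oracle)
    (x : List Bool) (us : List (List Bool)) (pre : List (List Bool)) (w : List Bool) (k : ℕ)
    (hstep : ∀ (i : ℕ) (hi : i < us.length), M.step x (pre ++ (us.take i).map O) = Sum.inl (us[i]))
    (hout : M.step x (pre ++ us.map O) = Sum.inr w) (hk : us.length < k) :
    (M.postOut h).runAux O x k pre =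
        some ((h (boolPair x (boolPair ((encodingList Bool).listBool.encode (pre ++ us.map O)) w))).headD false) ∧
      (M.postOut h).queriesAux O x k pre = us :=
  (M.postOut h).runAux_of_trace O x us pre _ k
    (fun i hi => by rw [postOut_step, hstep i hi])
    (by rw [postOut_step, hout]) hk

/-- **`postOut` from a run of `M`**: if `M.runAux O x k pre = some w` then `M.postOut h` outputs the
bit computed from the final transcript `pre ++ (queries).map O`. [Arora–Barak 2009, §3.4] [folklore] -/
theorem runAux_postOut (M : OracleAlg (List Bool)) (h : List Bool → List Bool) (O : Oracle)
    (x : List Bool) (k : ℕ) (pre : List (List Bool)) (w : List Bool)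
    (hrun : M.runAux O x k pre = some w) :
    (M.postOut h).runAux O x k pre =
        some ((h (boolPair x (boolPair
          ((encodingList Bool).listBool.encode (pre ++ (M.queriesAux O x k pre).map O)) w))).headD false) ∧
      (M.postOut h).queriesAux O x k pre = M.queriesAux O x k pre := by
  obtain ⟨us, hlen, hstep, hout, hus⟩ := M.exists_trace_of_runAux O x k pre w hrun
  rw [hus]
  exact runAux_postOut_of_trace M h O x us pre w k hstep hout hlen

/-! ### Erasing the answers -/

/-- **`M.eraseAns`**: run `M` as if every answer received were the empty string. [folklore] -/
def eraseAns (M : OracleAlg β) : OracleAlg β where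
  step x as := M.step x (as.map fun _ => [])

/-- The step of `M.eraseAns` (definitional). [folklore] -/
theorem eraseAns_step (M : OracleAlg β) (x : List Bool) (as : List (List Bool)) :
    M.eraseAns.step x as = M.step x (as.map fun _ => []) :=
  rfl

/-- **Run semantics of `eraseAns`**: against every oracle, `M.eraseAns` runs as `M` against the
oracle answering `ε`. [Arora–Barak 2009, §3.4] [folklore] -/
theorem runAux_eraseAns (M : OracleAlg β) (O : Oracle) (x : List Bool) :
    ∀ (n : ℕ) (as : List (List Bool)),
      M.eraseAns.runAux O x n as = M.runAux (fun _ => []) x n (as.map fun _ => [])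
  | 0, _ => rfl
  | n + 1, as => by
    rw [runAux_succ, runAux_succ, eraseAns_step]
    cases M.step x (as.map fun _ => []) with
    | inr b => rfl
    | inl q =>
      dsimp only
      rw [runAux_eraseAns M O x n (as ++ [O q]), List.map_append, List.map_singleton]

/-- Hence `M.eraseAns.run O n x = M.run (fun _ => []) n x`. [folklore] -/
@[simp] theorem run_eraseAns (M : OracleAlg β) (O : Oracle) (n : ℕ) (x : List Bool) :
    M.eraseAns.run O n x = M.run (fun _ => []) n x :=
  runAux_eraseAns M O x n []

/-- The queries of `M.eraseAns` are those of `M` against the `ε`-oracle. [folklore] -/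
theorem queriesAux_eraseAns (M : OracleAlg β) (O : Oracle) (x : List Bool) :
    ∀ (n : ℕ) (as : List (List Bool)),
      M.eraseAns.queriesAux O x n as = M.queriesAux (fun _ => []) x n (as.map fun _ => [])
  | 0, _ => rfl
  | n + 1, as => by
    unfold queriesAux
    rw [eraseAns_step]
    cases M.step x (as.map fun _ => []) with
    | inr b => rfl
    | inl q =>
      dsimp only
      rw [queriesAux_eraseAns M O x n (as ++ [O q]), List.map_append, List.map_singleton]

/-! ### Polynomial time -/

section PolyTime

open PrePost EmptySim QueryMapPoly Brick

variable (eb : Encoding β Bool)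

namespace PrefixPostPoly

/-! #### String plumbing on the step-function input `⟨x, listBool as⟩` -/

/-- The body of the `listBool` code of a transcript is the nested-pair coding `encList`
(`StackLists.lean`). [H21 design C2] [folklore] -/
theorem foldr_boolPair_eq_encList (l : List (List Bool)) :
    l.foldr (fun a acc => boolPair ((encodingList Bool).encode a) acc) [] = encList l := by
  induction l with
  | nil => rfl
  | cons a l ih => rw [List.foldr_cons, ih]; rfl

/-- The `listBool` code of a transcript is `⟨1^{|as|}, encList as⟩` (twin of
`Cryptography.ShorFP.listBool_encode_eq_encList`, `ShorStepFP.lean`, outside this file's import cone).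
[H21 design C2] [folklore] -/
theorem listBool_encode_eq (l : List (List Bool)) :
    (encodingList Bool).listBool.encode l = boolPair (unaryEncodeNat l.length) (encList l) := by
  change boolPair (unaryEncodeNat l.length) (l.foldr (fun a acc => boolPair ((encodingList Bool).encode a) acc) []) = _
  rw [foldr_boolPair_eq_encList]

/-- Dropping `k` ones from `1ⁿ` leaves `1^{n-k}`. [folklore] -/
theorem drop_unaryEncodeNat (k n : ℕ) : (unaryEncodeNat n).drop k = unaryEncodeNat (n - k) := by
  rw [unaryEncodeNat_eq_replicate, unaryEncodeNat_eq_replicate, List.drop_replicate]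

/-- Dropping `k` symbols, as an iterate of the tail transducer. [folklore] -/
noncomputable def dropSym : ℕ → (List Bool → List Bool)
  | 0 => id
  | k + 1 => PRelSigma.tailT.eval ∘ dropSym k

/-- `dropSym k w = w ⇂ k`. [folklore] -/
@[simp] theorem dropSym_apply : ∀ (k : ℕ) (w : List Bool), dropSym k w = w.drop k
  | 0, w => rfl
  | k + 1, w => by
    rw [dropSym, Function.comp_apply, dropSym_apply k w, PRelSigma.tailT_eval, List.tail_drop]

/-- `dropSym k ∈ FP`. [folklore] -/
theorem dropSym_mem_FP : ∀ k : ℕ, dropSym k ∈ FP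
  | 0 => PolyTimeComputable.id _
  | k + 1 => comp_mem_FP PRelSigma.tailT.polyTimeComputable_eval (dropSym_mem_FP k)

/-- `k` second projections. [folklore] -/
noncomputable def iterSnd : ℕ → (List Bool → List Bool)
  | 0 => id
  | k + 1 => sndF ∘ iterSnd k

/-- `iterSnd k ∈ FP`. [folklore] -/
theorem iterSnd_mem_FP : ∀ k : ℕ, iterSnd k ∈ FP
  | 0 => PolyTimeComputable.id _
  | k + 1 => comp_mem_FP sndF_mem_FP (iterSnd_mem_FP k)

/-- `iterSnd k` drops `k` items of a coded list (`Brick.sndF_encList`). [folklore] -/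
@[simp] theorem iterSnd_encList : ∀ (k : ℕ) (l : List (List Bool)), iterSnd k (encList l) = encList (l.drop k)
  | 0, _ => rfl
  | k + 1, l => by
    rw [iterSnd, Function.comp_apply, iterSnd_encList k l, sndF_encList, List.tail_drop]

/-- On step inputs: `dropK k ⟨x, listBool as⟩ = ⟨x, listBool (as ⇂ k)⟩`. [folklore] -/
noncomputable def dropK (k : ℕ) : List Bool → List Bool :=
  fanoutFn fstF (fanoutFn (dropSym k ∘ fstF ∘ sndF) (iterSnd k ∘ sndF ∘ sndF))

/-- The value of `dropK` on a step input. [folklore] -/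
theorem dropK_encIn (k : ℕ) (x : List Bool) (as : List (List Bool)) :
    dropK k (encIn (x, as)) = encIn (x, as.drop k) := by
  simp only [dropK, encIn, listBool_encode_eq, fanoutFn_apply, Function.comp_apply, fstF_boolPair,
    sndF_boolPair, dropSym_apply, drop_unaryEncodeNat, iterSnd_encList, List.length_drop]

/-- `dropK k ∈ FP`. [folklore] -/
theorem dropK_mem_FP (k : ℕ) : dropK k ∈ FP :=
  fanoutFn_mem_FP fstF_mem_FP (fanoutFn_mem_FP
    (comp_mem_FP (dropSym_mem_FP k) (comp_mem_FP fstF_mem_FP sndF_mem_FP))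
    (comp_mem_FP (iterSnd_mem_FP k) (comp_mem_FP sndF_mem_FP sndF_mem_FP)))

/-! #### `prefixShift`: stages -/

/-- Stage A of `prefixShift`: `(x, as) ↦ ((x, as ⇂ k), (x, as))`. [folklore] -/
def stAk (k : ℕ) (p : St) : St × St := ((p.1, p.2.drop k), p)

/-- **Stage A of `prefixShift` is polynomial-time** (`dropK` on a copy, then `toField`). [Arora–Barak 2009, §1.3] [folklore] -/
theorem polyTime_stAk (k : ℕ) : PolyTimeComputable encIn encA (stAk k) := by
  have hS : PolyTimeComputable (id : List Bool → List Bool) (id : List (Option Bool) → _)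
      (toField.eval ∘ fanoutFn (dropK k) id) :=
    PolyTimeComputable.comp_holds toField.polyTimeComputable_eval
      (fanoutFn_mem_FP (dropK_mem_FP k) (PolyTimeComputable.id _))
  refine PolyTimeComputable.of_encode hS encIn (fun _ => rfl) fun p => ?_
  obtain ⟨x, as⟩ := p
  simp only [id, Function.comp_apply, encA, stAk, fanoutFn_apply, dropK_encIn, toField_eval]

/-- Stage C of `prefixShift` (typed): blank query while `|as| < k`, else the step result. [folklore] -/
def stPS (k : ℕ) (r : (List Bool ⊕ β) × St) : List Bool ⊕ β :=
  if r.2.2.length < k then Sum.inl [] else r.1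

/-- The step of `M.prefixShift k` factors through the stages. [folklore] -/
theorem uncurry_prefixShift_step (M : OracleAlg β) (k : ℕ) :
    Function.uncurry (M.prefixShift k).step = stPS k ∘ Prod.map (Function.uncurry M.step) id ∘ stAk k := by
  funext p
  obtain ⟨x, as⟩ := p
  simp only [Function.uncurry_apply_pair, Function.comp_apply, stPS, stAk, Prod.map_apply, id,
    prefixShift_step]

/-- `[|as| < k]` read off the context of a stage-C input `⟨V, ⟨x, listBool as⟩⟩`: the clock test
`cClk` of `OracleQueryMap.lean` with the constant polynomial `k`. [folklore] -/
noncomputable def condK (k : ℕ) : List Bool → List Bool := cClk (Polynomial.C k) ∘ sndF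

/-- The value of `condK`. [folklore] -/
theorem condK_apply (k : ℕ) (V x : List Bool) (as : List (List Bool)) :
    condK k (boolPair V (encIn (x, as))) = [decide (as.length < k)] := by
  rw [condK, Function.comp_apply, sndF_boolPair, encIn, cClk_apply, Polynomial.eval_C]

/-- `condK k ∈ FP`. [folklore] -/
theorem condK_mem_FP (k : ℕ) : condK k ∈ FP := comp_mem_FP (cClk_mem_FP _) sndF_mem_FP

/-- Stage C of `prefixShift` as a string map. [folklore] -/
noncomputable def GPS (k : ℕ) : List (Option Bool) → List Bool :=
  iteFn (condK k) (fun _ => [false]) fstF ∘ fromField.eval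

/-- **Stage C of `prefixShift` is polynomial-time.** [Arora–Barak 2009, §1.3] [folklore] -/
theorem polyTime_stPS (k : ℕ) :
    PolyTimeComputable (encQ eb) ((encodingList Bool).sumBool eb).encode (stPS (β := β) k) := by
  have hW : (iteFn (condK k) (fun _ => [false]) fstF) ∈ FP :=
    iteFn_mem_FP (condK_mem_FP k) (const_mem_FP _) fstF_mem_FP
  have hS : PolyTimeComputable (id : List (Option Bool) → _) (id : List Bool → List Bool) (GPS k) :=
    PolyTimeComputable.comp_holds hW fromField.polyTimeComputable_eval
  refine PolyTimeComputable.of_encode hS (encQ eb) (fun _ => rfl) fun r => ?_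
  obtain ⟨r, x, as⟩ := r
  have hin : encIn (x, as) = boolPair x ((encodingList Bool).listBool.encode as) := rfl
  simp only [id, GPS, Function.comp_apply, encQ, fromField_eval, stPS]
  by_cases hc : as.length < k
  · rw [iteFn_apply_true (by rw [condK_apply]; simp [hc]), if_pos hc]
    rfl
  · rw [iteFn_apply_false (by rw [condK_apply]; simp [hc]), if_neg hc, fstF_boolPair]

/-! #### `postOut`: stage C -/

/-- Stage C of `postOut` (typed). [folklore] -/
def stPO (h : List Bool → List Bool) (r : (List Bool ⊕ List Bool) × St) : List Bool ⊕ Bool :=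
  match r.1 with
  | Sum.inl q => Sum.inl q
  | Sum.inr w =>
    Sum.inr ((h (boolPair r.2.1 (boolPair ((encodingList Bool).listBool.encode r.2.2) w))).headD false)

/-- The step of `M.postOut h` factors through the stages. [folklore] -/
theorem uncurry_postOut_step (M : OracleAlg (List Bool)) (h : List Bool → List Bool) :
    Function.uncurry (M.postOut h).step = stPO h ∘ Prod.map (Function.uncurry M.step) id ∘ fun p : St => (p, p) := by
  funext p
  obtain ⟨x, as⟩ := p
  simp only [Function.uncurry_apply_pair, Function.comp_apply, stPO, Prod.map_apply, id, postOut_step]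

/-- The context record `⟨x, ⟨listBool as, w⟩⟩` assembled from a stage-C input `⟨1w, ⟨x, listBool as⟩⟩`. [folklore] -/
noncomputable def ctxPO : List Bool → List Bool :=
  fanoutFn (fstF ∘ sndF) (fanoutFn (sndF ∘ sndF) (PRelSigma.tailT.eval ∘ fstF))

/-- `ctxPO ∈ FP`. [folklore] -/
theorem ctxPO_mem_FP : ctxPO ∈ FP :=
  fanoutFn_mem_FP (comp_mem_FP fstF_mem_FP sndF_mem_FP) (fanoutFn_mem_FP (comp_mem_FP sndF_mem_FP sndF_mem_FP)
    (comp_mem_FP PRelSigma.tailT.polyTimeComputable_eval fstF_mem_FP))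

/-- The value of `ctxPO`. [folklore] -/
theorem ctxPO_apply (t : Bool) (w x : List Bool) (as : List (List Bool)) :
    ctxPO (boolPair (t :: w) (encIn (x, as))) = boolPair x (boolPair ((encodingList Bool).listBool.encode as) w) := by
  simp only [ctxPO, encIn, fanoutFn_apply, Function.comp_apply, sndF_boolPair, fstF_boolPair, PRelSigma.tailT_eval,
    List.tail_cons]

/-- `headD false` as the first-symbol test. [folklore] -/
theorem headT_true_eval_eq (u : List Bool) : (PRelSigma.headT true).eval u = [u.headD false] := by
  rw [PRelSigma.headT_eval]
  cases u with
  | nil => rfl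
  | cons b u => cases b <;> rfl

/-- Stage C of `postOut` as a string map. [folklore] -/
noncomputable def GPO (h : List Bool → List Bool) : List (Option Bool) → List Bool :=
  iteFn (headT.eval ∘ fstF) (List.cons true ∘ (PRelSigma.headT true).eval ∘ h ∘ ctxPO) fstF ∘ fromField.eval

/-- **Stage C of `postOut` is polynomial-time** for `h ∈ FP`. [Arora–Barak 2009, §1.3] [folklore] -/
theorem polyTime_stPO {h : List Bool → List Bool} (hh : h ∈ FP) :
    PolyTimeComputable (encQ (encodingList Bool)) ((encodingList Bool).sumBool encodingBoolBool).encode (stPO h) := by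
  have hW : (iteFn (headT.eval ∘ fstF) (List.cons true ∘ (PRelSigma.headT true).eval ∘ h ∘ ctxPO) fstF) ∈ FP :=
    iteFn_mem_FP (comp_mem_FP headT.polyTimeComputable_eval fstF_mem_FP)
      (comp_mem_FP (cons_mem_FP true) (comp_mem_FP (PRelSigma.headT true).polyTimeComputable_eval
        (comp_mem_FP hh ctxPO_mem_FP))) fstF_mem_FP
  have hS : PolyTimeComputable (id : List (Option Bool) → _) (id : List Bool → List Bool) (GPO h) :=
    PolyTimeComputable.comp_holds hW fromField.polyTimeComputable_eval
  refine PolyTimeComputable.of_encode hS (encQ (encodingList Bool)) (fun _ => rfl) fun r => ?_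
  obtain ⟨r, x, as⟩ := r
  have hin : encIn (x, as) = boolPair x ((encodingList Bool).listBool.encode as) := rfl
  have hid : ∀ w : List Bool, (encodingList Bool).encode w = w := fun _ => rfl
  simp only [id, GPO, Function.comp_apply, encQ, fromField_eval]
  cases r with
  | inl q =>
    have hcode : ((encodingList Bool).sumBool (encodingList Bool)).encode (Sum.inl q : List Bool ⊕ List Bool) = false :: q := by
      simp [Encoding.sumBool, hid]
    rw [hcode, iteFn_apply_false (by simp [headT_eval_cons]), fstF_boolPair]
    simp [stPO, Encoding.sumBool, hid]
  | inr w =>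
    have hcode : ((encodingList Bool).sumBool (encodingList Bool)).encode (Sum.inr w : List Bool ⊕ List Bool) = true :: w := by
      simp [Encoding.sumBool, hid]
    rw [hcode, iteFn_apply_true (by simp [headT_eval_cons])]
    simp only [Function.comp_apply]
    rw [ctxPO_apply, headT_true_eval_eq]
    simp only [stPO, Encoding.sumBool, List.headD_eq_head?_getD]
    rfl

/-! #### `eraseAns`: the input transform -/

/-- The transducer writing `01` for every symbol read: on `1ᵐ` it produces
`encList [ε, …, ε] = (01)ᵐ`. [folklore] -/
def emptiesT : FST Unit Bool Bool where
  init := ()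
  step := fun _ _ => ((), [false, true])
  front := fun _ => []
  keep := fun _ => true

/-- The body emitted by `emptiesT`. [folklore] -/
theorem emptiesT_run (l : List Bool) : (emptiesT.run () l).2 = encList (l.map fun _ => []) := by
  induction l with
  | nil => rfl
  | cons b l ih =>
    rw [FST.run_cons, show (emptiesT.step () b) = ((), [false, true]) from rfl]
    dsimp only
    rw [ih, List.map_cons, encList_cons]
    rfl

/-- `emptiesT` on `1ᵐ` computes the body of the code of `m` empty answers. [folklore] -/
theorem emptiesT_eval (m : ℕ) : emptiesT.eval (unaryEncodeNat m) = encList (List.replicate m []) := by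
  simp only [FST.eval, show emptiesT.init = () from rfl, show ∀ s, emptiesT.keep s = true from fun _ => rfl,
    show ∀ s, emptiesT.front s = [] from fun _ => rfl, if_true, List.nil_append, emptiesT_run,
    unaryEncodeNat_eq_replicate, List.map_replicate]

/-- The input transform of `eraseAns` as a string map: `⟨x, ⟨1ᵐ, body⟩⟩ ↦ ⟨x, ⟨1ᵐ, (01)ᵐ⟩⟩`. [folklore] -/
noncomputable def eraseF : List Bool → List Bool :=
  fanoutFn fstF (fanoutFn (fstF ∘ sndF) (emptiesT.eval ∘ fstF ∘ sndF))

/-- `eraseF ∈ FP`. [folklore] -/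
theorem eraseF_mem_FP : eraseF ∈ FP :=
  fanoutFn_mem_FP fstF_mem_FP (fanoutFn_mem_FP (comp_mem_FP fstF_mem_FP sndF_mem_FP)
    (comp_mem_FP emptiesT.polyTimeComputable_eval (comp_mem_FP fstF_mem_FP sndF_mem_FP)))

/-- The value of `eraseF` on a step input. [folklore] -/
theorem eraseF_encIn (x : List Bool) (as : List (List Bool)) :
    eraseF (encIn (x, as)) = encIn (x, as.map fun _ => []) := by
  simp only [eraseF, encIn, listBool_encode_eq, fanoutFn_apply, Function.comp_apply, fstF_boolPair, sndF_boolPair,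
    emptiesT_eval, List.map_const', List.length_replicate]

/-- **The input transform of `eraseAns` is polynomial-time** on step inputs. [Arora–Barak 2009, §1.3] [folklore] -/
theorem polyTime_eraseIn :
    PolyTimeComputable encIn encIn (fun p : St => ((p.1, p.2.map fun _ => []) : St)) := by
  refine PolyTimeComputable.of_encode eraseF_mem_FP encIn (fun _ => rfl) fun p => ?_
  obtain ⟨x, as⟩ := p
  exact eraseF_encIn x as

end PrefixPostPoly

open PrefixPostPoly

/-- **`M.prefixShift k` is polynomial-time** when `M` is. [Arora–Barak 2009, §3.4 with §1.3] [cite: AroraBarak2009, §3.4] -/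
theorem isPolyTime_prefixShift {M : OracleAlg β} (hM : M.IsPolyTime eb) (k : ℕ) :
    (M.prefixShift k).IsPolyTime eb := by
  unfold IsPolyTime
  rw [uncurry_prefixShift_step]
  exact PolyTimeComputable.comp_holds (polyTime_stPS eb k)
    (PolyTimeComputable.comp_holds (polyTime_stB eb hM) (polyTime_stAk k))

/-- **`M.postOut h` is polynomial-time** for `M` polynomial-time and `h ∈ FP`. [Arora–Barak 2009, §3.4 with §1.3] [cite: AroraBarak2009, §3.4] -/
theorem isPolyTime_postOut {M : OracleAlg (List Bool)} (hM : M.IsPolyTime (encodingList Bool))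
    {h : List Bool → List Bool} (hh : h ∈ FP) : (M.postOut h).IsPolyTime encodingBoolBool := by
  unfold IsPolyTime
  rw [uncurry_postOut_step]
  exact PolyTimeComputable.comp_holds (polyTime_stPO hh)
    (PolyTimeComputable.comp_holds (polyTime_stB (encodingList Bool) hM) polyTime_stageA)

/-- **`M.eraseAns` is polynomial-time** when `M` is. [Arora–Barak 2009, §3.4 with §1.3] [cite: AroraBarak2009, §3.4] -/
theorem isPolyTime_eraseAns {M : OracleAlg β} (hM : M.IsPolyTime eb) : M.eraseAns.IsPolyTime eb := by
  have h := PolyTimeComputable.comp_holds hM polyTime_eraseIn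
  exact h

end PolyTime

/-! ### Budgeted oracle-free runs are decidable in `P` -/

section RunEmpty

/-- With queries rewritten to a constant `c`, `M` runs as against the constant oracle `O c`. [folklore] -/
theorem runAux_mapQuery_const (M : OracleAlg β) (c : List Bool) (O : Oracle) (x : List Bool) :
    ∀ (n : ℕ) (as : List (List Bool)),
      (M.mapQuery fun _ => c).runAux O x n as = M.runAux (fun _ => O c) x n as
  | 0, _ => rfl
  | n + 1, as => by
    rw [runAux_succ, runAux_succ, mapQuery_step]
    cases M.step x as with
    | inr b => rfl
    | inl q => exact runAux_mapQuery_const M c O x n _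

/-- With queries rewritten to a constant `c`, every query asked is `c`. [folklore] -/
theorem eq_of_mem_queriesAux_mapQuery_const (M : OracleAlg β) (c : List Bool) (O : Oracle) (x : List Bool) :
    ∀ (n : ℕ) (as : List (List Bool)) (y : List Bool),
      y ∈ (M.mapQuery fun _ => c).queriesAux O x n as → y = c
  | 0, _, _, h => by simp [queriesAux] at h
  | n + 1, as, y, h => by
    unfold queriesAux at h
    rw [mapQuery_step] at h
    cases hs : M.step x as with
    | inr b => rw [hs] at h; simp at h
    | inl q =>
      rw [hs] at h
      rcases List.mem_cons.1 h with rfl | h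
      · rfl
      · exact eq_of_mem_queriesAux_mapQuery_const M c O x n _ y h

/-- **The language of budgeted oracle-free runs** of `E : OracleAlg Bool`: `v = ⟨u, y⟩` is in
`runEmptyLang E` iff `E`, run on `y` for `|u|` rounds with every query answered by `ε`, outputs
`true` (no output within the budget counts as `false`, the convention of `Learning.evalHyp`).
[Arora–Barak 2009, §3.4 Example 3.6 (2)] [folklore] -/
def runEmptyLang (E : OracleAlg Bool) : Language Bool :=
  {v | (E.run (fun _ => []) (Brick.fstF v).length (Brick.sndF v)).getD false = true}

/-- Membership in `runEmptyLang` on a pair. [folklore] -/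
theorem boolPair_mem_runEmptyLang_iff (E : OracleAlg Bool) (u y : List Bool) :
    boolPair u y ∈ runEmptyLang E ↔ (E.run (fun _ => []) u.length y).getD false = true := by
  change (E.run (fun _ => []) (Brick.fstF (boolPair u y)).length (Brick.sndF (boolPair u y))).getD false = true ↔ _
  rw [Brick.fstF_boolPair, Brick.sndF_boolPair]

/-- The indicator of `runEmptyLang E` is the defaulted run output. [folklore] -/
theorem boolIndicator_runEmptyLang (E : OracleAlg Bool) (v : List Bool) :
    (runEmptyLang E).boolIndicator v = (E.run (fun _ => []) (Brick.fstF v).length (Brick.sndF v)).getD false := by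
  unfold Set.boolIndicator runEmptyLang
  cases h : (E.run (fun _ => []) (Brick.fstF v).length (Brick.sndF v)).getD false <;> simp [h]

/-- **The simulator**: erase the answers, blank the queries, read the input off the second
field, clock by the length of the first field. [Arora–Barak 2009, §3.4 with §1.4.1] [folklore] -/
noncomputable def runEmptyAlg (E : OracleAlg Bool) : OracleAlg Bool :=
  ((E.eraseAns.mapQuery fun _ => []).comap Brick.sndF).clockFst Polynomial.X false

/-- **The simulator computes the defaulted oracle-free run**, against every oracle, within any
budget exceeding `|u|`. [Arora–Barak 2009, §3.4] [folklore] -/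
theorem run_runEmptyAlg (E : OracleAlg Bool) (O : Oracle) (v : List Bool) {n : ℕ}
    (hn : (Brick.fstF v).length < n) :
    (runEmptyAlg E).run O n v = some ((E.run (fun _ => []) (Brick.fstF v).length (Brick.sndF v)).getD false) := by
  unfold runEmptyAlg clockFst
  rw [run_clockBy _ _ _ O v (by simpa [Brick.fstF] using hn), Polynomial.eval_X]
  congr 2
  change ((E.eraseAns.mapQuery fun _ => []).comap Brick.sndF).runAux O v _ [] = _
  rw [runAux_comap, runAux_mapQuery_const, runAux_eraseAns]
  rfl

/-- Every query of the simulator is the blank query. [folklore] -/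
theorem eq_nil_of_mem_queries_runEmptyAlg (E : OracleAlg Bool) (O : Oracle) (v : List Bool) (n : ℕ)
    {y : List Bool} (hy : y ∈ (runEmptyAlg E).queries O n v) : y = [] := by
  unfold runEmptyAlg clockFst at hy
  have h1 := queriesAux_clockBy_subset _ _ _ O v n [] y hy
  rw [queriesAux_comap] at h1
  exact eq_of_mem_queriesAux_mapQuery_const _ _ O _ n [] y h1

/-- **`runEmptyLang E ∈ P^O` for every oracle `O`** (polynomial-time `E`): the simulator never
uses its oracle. [Arora–Barak 2009, §3.4 Example 3.6 (2)] [cite: AroraBarak2009, §3.4] -/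
theorem runEmptyLang_mem_PRel {E : OracleAlg Bool} (hE : E.IsPolyTime encodingBoolBool) (O : Oracle) :
    runEmptyLang E ∈ PRel O := by
  refine ⟨runEmptyAlg E, ?_, Polynomial.X + 1, fun v => ⟨?_, fun y hy => ?_⟩⟩
  · exact isPolyTime_clockFst _ (isPolyTime_comap _ (isPolyTime_mapQuery _ (isPolyTime_eraseAns _ hE)
      (const_mem_FP [])) Brick.sndF_mem_FP) _ _
  · have hlt : (Brick.fstF v).length < (Polynomial.X + 1 : Polynomial ℕ).eval v.length := by
      have := Brick.length_fstF_sndF_le v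
      simp; omega
    rw [run_runEmptyAlg E O v hlt, boolIndicator_runEmptyLang]
  · rw [eq_nil_of_mem_queries_runEmptyAlg E O v _ hy]
    simp

/-- **`runEmptyLang E ∈ P`** for polynomial-time `E` (`P^∅ = P`). [Arora–Barak 2009, §3.4 Example 3.6 (2); Baker–Gill–Solovay 1975, §1] [cite: AroraBarak2009, §3.4] -/
theorem runEmptyLang_mem_P {E : OracleAlg Bool} (hE : E.IsPolyTime encodingBoolBool) :
    runEmptyLang E ∈ Classes.P := by
  have h := runEmptyLang_mem_PRel hE Oracle.empty
  rwa [show PRel Oracle.empty = Classes.P from PRel_empty_holds] at h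

end RunEmpty

end OracleAlg

end Literature.Computability.Complexity
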